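import Summits.AnomalousDissipation.AnomalousDissipation.Theses.EnsembleRigidity
import Literature.Analysis.FluidPDE.DoeringFoiasAmplitudeProofs
import Literature.Analysis.FluidPDE.EnergySpaceTorusHilbertBasisProofs
import Literature.Analysis.FluidPDE.TorusForceBookkeeping

/-!
# Level floor for `EnsembleRigidity.GPMeanBoundedFamily` (stmt-AnomalousDissipation-15509) — negative side

cdisprove seat `refuter-cdisprove-stmt-AnomalousDissipation-15509-0` (2026-08-16).

The crux asks for a level `E` and a lifted zero-momentum Leray–Hopf family of NS_{ν_j}(f_GP), `ν_j → 0`,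
with `meanEnergy (u_j) ≤ E`.  This file pins the **bottom of the admissible level range**: the
Galloway–Proctor force `f_GP = sin(2πx₂)e₀ + sin(2πx₀)e₁ + sin(2πx₁)e₂` is `F Φ` for the Doering–Foias
forcing shape `Φ = (2/3)^{1/2} f_GP` (`‖f_GP‖₂² = 3/2`, `F = (3/2)^{1/2}`, scale `ℓ = 1`), so the in-tree
Doering–Foias amplitude bound `|F| ≤ C U² + ν K U` (`DoeringFoias.abs_amplitude_le_of_isGlobalLerayHopf`,
Cheskidov–Doering–Petrov 2007 eq. (18)) gives a constant `e₀ > 0` with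

  `e₀ ≤ meanEnergy u` for EVERY global Leray–Hopf solution `u` of NS_ν(f_GP), every datum, every `ν ∈ (0,1]`

(`exists_meanEnergy_floor`).  Consequences for the crux (both conclusions are constraints on / negations of
strengthenings of the route decl, never the decl itself):

* `level_floor` — every witness `(E, ν, u₀, u, U)` of the body of `GPMeanBoundedFamily` has `e₀ ≤ E`;
* `not_atEveryLevel` — the natural strengthening "mean-bounded GP families exist at EVERY positive level"
  (stated inline) is FALSE.

Together with the per-viscosity ceiling `meanEnergy ≤ 16‖f_GP‖₂²/ν²` (in tree, `timeMean_norm_sq_le`;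
refuter `rattack` Mutation.lean `perViscosity`) this brackets every witness level in `[e₀, 24/ν_j²]`; the
crux is exactly the assertion that the `j`-uniform part of this bracket is inhabited.
-/

noncomputable section

open MeasureTheory Filter Set
open scoped RealInnerProductSpace

namespace Summit.AnomalousDissipation.AnomalousDissipation.Theorems.GPMeanBoundedFamily.Negative

open Literature.Analysis Literature.Analysis.FunctionSpaces Literature.Analysis.FluidPDE

/-- The three first-shell frequencies of `f_GP`. [folklore] -/
private theorem freq_facts :
    ((Pi.single (2 : Fin 3) (1 : ℤ) : Fin 3 → ℤ) ≠ 0) ∧ ((Pi.single (0 : Fin 3) (1 : ℤ) : Fin 3 → ℤ) ≠ 0) ∧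
    ((Pi.single (1 : Fin 3) (1 : ℤ) : Fin 3 → ℤ) ≠ 0) ∧
    ((Pi.single (2 : Fin 3) (1 : ℤ) : Fin 3 → ℤ) ≠ (Pi.single (0 : Fin 3) (1 : ℤ) : Fin 3 → ℤ)) ∧
    ((Pi.single (2 : Fin 3) (1 : ℤ) : Fin 3 → ℤ) ≠ -(Pi.single (0 : Fin 3) (1 : ℤ) : Fin 3 → ℤ)) ∧
    ((Pi.single (2 : Fin 3) (1 : ℤ) : Fin 3 → ℤ) ≠ (Pi.single (1 : Fin 3) (1 : ℤ) : Fin 3 → ℤ)) ∧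
    ((Pi.single (2 : Fin 3) (1 : ℤ) : Fin 3 → ℤ) ≠ -(Pi.single (1 : Fin 3) (1 : ℤ) : Fin 3 → ℤ)) ∧
    ((Pi.single (0 : Fin 3) (1 : ℤ) : Fin 3 → ℤ) ≠ (Pi.single (1 : Fin 3) (1 : ℤ) : Fin 3 → ℤ)) ∧
    ((Pi.single (0 : Fin 3) (1 : ℤ) : Fin 3 → ℤ) ≠ -(Pi.single (1 : Fin 3) (1 : ℤ) : Fin 3 → ℤ)) := by
  decide

/-- **`‖f_GP‖₂² = 3/2`** (three orthogonal sine modes, each of squared norm `‖eᵢ‖²/2 = 1/2`). [folklore] -/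
theorem integral_norm_sq_gpForce : ∫ x, ‖(fun x : UnitAddTorus (Fin 3) =>
      (Torus.stokesMode (Pi.single (2 : Fin 3) (1 : ℤ)) (EuclideanSpace.single (0 : Fin 3) (1 : ℝ)) false x +
        Torus.stokesMode (Pi.single (0 : Fin 3) (1 : ℤ)) (EuclideanSpace.single (1 : Fin 3) (1 : ℝ)) false x +
        Torus.stokesMode (Pi.single (1 : Fin 3) (1 : ℤ)) (EuclideanSpace.single (2 : Fin 3) (1 : ℝ)) false x :
        EuclideanSpace ℝ (Fin 3))) x‖ ^ 2 = 3 / 2 := by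
  obtain ⟨h1, h2, h3, h12, h12', h13, h13', h23, h23'⟩ := freq_facts
  set m₁ := Torus.stokesModeL2 (d := Fin 3) (Pi.single (2 : Fin 3) (1 : ℤ)) (EuclideanSpace.single (0 : Fin 3) (1 : ℝ)) false
    with hm₁
  set m₂ := Torus.stokesModeL2 (d := Fin 3) (Pi.single (0 : Fin 3) (1 : ℤ)) (EuclideanSpace.single (1 : Fin 3) (1 : ℝ)) false
    with hm₂
  set m₃ := Torus.stokesModeL2 (d := Fin 3) (Pi.single (1 : Fin 3) (1 : ℤ)) (EuclideanSpace.single (2 : Fin 3) (1 : ℝ)) false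
    with hm₃
  set G := m₁ + m₂ + m₃ with hG
  -- `G` is represented by `f_GP`
  have hae : (G : UnitAddTorus (Fin 3) → EuclideanSpace ℝ (Fin 3)) =ᵐ[volume] (fun x : UnitAddTorus (Fin 3) =>
      (Torus.stokesMode (Pi.single (2 : Fin 3) (1 : ℤ)) (EuclideanSpace.single (0 : Fin 3) (1 : ℝ)) false x +
        Torus.stokesMode (Pi.single (0 : Fin 3) (1 : ℤ)) (EuclideanSpace.single (1 : Fin 3) (1 : ℝ)) false x +
        Torus.stokesMode (Pi.single (1 : Fin 3) (1 : ℤ)) (EuclideanSpace.single (2 : Fin 3) (1 : ℝ)) false x :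
        EuclideanSpace ℝ (Fin 3))) := by
    have e12 := (Lp.coeFn_add m₁ m₂).trans
      ((Torus.coeFn_stokesModeL2 _ _ _).add (Torus.coeFn_stokesModeL2 _ _ _))
    have e123 := (Lp.coeFn_add (m₁ + m₂) m₃).trans (e12.add (Torus.coeFn_stokesModeL2 _ _ _))
    exact e123.trans (Filter.EventuallyEq.of_eq rfl)
  -- `⟪G, G⟫ = ∫ ‖f_GP‖²`
  have hinner : ⟪G, G⟫ = ∫ x, ‖(fun x : UnitAddTorus (Fin 3) =>
      (Torus.stokesMode (Pi.single (2 : Fin 3) (1 : ℤ)) (EuclideanSpace.single (0 : Fin 3) (1 : ℝ)) false x +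
        Torus.stokesMode (Pi.single (0 : Fin 3) (1 : ℤ)) (EuclideanSpace.single (1 : Fin 3) (1 : ℝ)) false x +
        Torus.stokesMode (Pi.single (1 : Fin 3) (1 : ℤ)) (EuclideanSpace.single (2 : Fin 3) (1 : ℝ)) false x :
        EuclideanSpace ℝ (Fin 3))) x‖ ^ 2 := by
    rw [MeasureTheory.L2.inner_def]
    refine integral_congr_ae (hae.mono fun x hx => ?_)
    simp only [hx, real_inner_self_eq_norm_sq]
  -- expand the Gram sum
  have n0 : ‖(EuclideanSpace.single (0 : Fin 3) (1 : ℝ))‖ = 1 := by simp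
  have n1 : ‖(EuclideanSpace.single (1 : Fin 3) (1 : ℝ))‖ = 1 := by simp
  have n2 : ‖(EuclideanSpace.single (2 : Fin 3) (1 : ℝ))‖ = 1 := by simp
  have d1 : ⟪m₁, m₁⟫ = 1 / 2 := by rw [hm₁, Torus.inner_stokesModeL2_self h1, n0]; norm_num
  have d2 : ⟪m₂, m₂⟫ = 1 / 2 := by rw [hm₂, Torus.inner_stokesModeL2_self h2, n1]; norm_num
  have d3 : ⟪m₃, m₃⟫ = 1 / 2 := by rw [hm₃, Torus.inner_stokesModeL2_self h3, n2]; norm_num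
  have o12 : ⟪m₁, m₂⟫ = 0 := by rw [hm₁, hm₂]; exact Torus.inner_stokesModeL2_of_ne h12 h12' _ _ _ _
  have o13 : ⟪m₁, m₃⟫ = 0 := by rw [hm₁, hm₃]; exact Torus.inner_stokesModeL2_of_ne h13 h13' _ _ _ _
  have o23 : ⟪m₂, m₃⟫ = 0 := by rw [hm₂, hm₃]; exact Torus.inner_stokesModeL2_of_ne h23 h23' _ _ _ _
  have o21 : ⟪m₂, m₁⟫ = 0 := by rw [real_inner_comm]; exact o12
  have o31 : ⟪m₃, m₁⟫ = 0 := by rw [real_inner_comm]; exact o13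
  have o32 : ⟪m₃, m₂⟫ = 0 := by rw [real_inner_comm]; exact o23
  have hsum : ⟪G, G⟫ = 3 / 2 := by
    simp only [hG, inner_add_left, inner_add_right, d1, d2, d3, o12, o13, o23, o21, o31, o32]
    norm_num
  rw [← hinner, hsum]

/-- **Level floor (Doering–Foias)**: there is `e₀ > 0` such that every global Leray–Hopf solution of
NS_ν(f_GP) with `0 < ν ≤ 1` — any datum, any momentum — has long-time mean energy `meanEnergy u ≥ e₀`.
Proof: `f_GP = F Φ_GP`, `F = (3/2)^{1/2}`, and the in-tree amplitude bound `|F| ≤ C U² + ν K U`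
(`U = (meanEnergy u)^{1/2}`, `C, K ≥ 0` depending on the shape only) forces `U ≥ min(1, F/(C+K+1))`.
[cite: CheskidovDoeringPetrov2006, §III eq. (18)] -/
theorem exists_meanEnergy_floor :
    ∃ e₀ : ℝ, 0 < e₀ ∧ ∀ (ν : ℝ) (u₀ : UnitAddTorus (Fin 3) → EuclideanSpace ℝ (Fin 3))
      (u : ℝ → UnitAddTorus (Fin 3) → EuclideanSpace ℝ (Fin 3)),
      0 < ν → ν ≤ 1 → Torus.IsGlobalLerayHopf ν (fun _ => (fun x : UnitAddTorus (Fin 3) =>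
      (Torus.stokesMode (Pi.single (2 : Fin 3) (1 : ℤ)) (EuclideanSpace.single (0 : Fin 3) (1 : ℝ)) false x +
        Torus.stokesMode (Pi.single (0 : Fin 3) (1 : ℤ)) (EuclideanSpace.single (1 : Fin 3) (1 : ℝ)) false x +
        Torus.stokesMode (Pi.single (1 : Fin 3) (1 : ℤ)) (EuclideanSpace.single (2 : Fin 3) (1 : ℝ)) false x :
        EuclideanSpace ℝ (Fin 3)))) u₀ u → e₀ ≤ meanEnergy u := by
  -- the Doering–Foias forcing shape `Φ_GP = (2/3)^{1/2} • f_GP` (smooth, solenoidal, mean zero, unit norm)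
  obtain ⟨hsm, hdf, hzm⟩ :=
    Summit.AnomalousDissipation.AnomalousDissipation.Theorems.SteadyStatesLoudBounded.GpAdmissible.stub_gpAdmissible
  have hnorm : ∫ x, ‖(Real.sqrt (2 / 3) • (fun x : UnitAddTorus (Fin 3) =>
      (Torus.stokesMode (Pi.single (2 : Fin 3) (1 : ℤ)) (EuclideanSpace.single (0 : Fin 3) (1 : ℝ)) false x +
        Torus.stokesMode (Pi.single (0 : Fin 3) (1 : ℤ)) (EuclideanSpace.single (1 : Fin 3) (1 : ℝ)) false x +
        Torus.stokesMode (Pi.single (1 : Fin 3) (1 : ℤ)) (EuclideanSpace.single (2 : Fin 3) (1 : ℝ)) false x :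
        EuclideanSpace ℝ (Fin 3)))) x‖ ^ 2 = 1 := by
    have h : ∀ x, ‖(Real.sqrt (2 / 3) • (fun x : UnitAddTorus (Fin 3) =>
      (Torus.stokesMode (Pi.single (2 : Fin 3) (1 : ℤ)) (EuclideanSpace.single (0 : Fin 3) (1 : ℝ)) false x +
        Torus.stokesMode (Pi.single (0 : Fin 3) (1 : ℤ)) (EuclideanSpace.single (1 : Fin 3) (1 : ℝ)) false x +
        Torus.stokesMode (Pi.single (1 : Fin 3) (1 : ℤ)) (EuclideanSpace.single (2 : Fin 3) (1 : ℝ)) false x :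
        EuclideanSpace ℝ (Fin 3)))) x‖ ^ 2 = (2 / 3) * ‖(fun x : UnitAddTorus (Fin 3) =>
      (Torus.stokesMode (Pi.single (2 : Fin 3) (1 : ℤ)) (EuclideanSpace.single (0 : Fin 3) (1 : ℝ)) false x +
        Torus.stokesMode (Pi.single (0 : Fin 3) (1 : ℤ)) (EuclideanSpace.single (1 : Fin 3) (1 : ℝ)) false x +
        Torus.stokesMode (Pi.single (1 : Fin 3) (1 : ℤ)) (EuclideanSpace.single (2 : Fin 3) (1 : ℝ)) false x :
        EuclideanSpace ℝ (Fin 3))) x‖ ^ 2 := fun x => by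
      rw [Pi.smul_apply, norm_smul, mul_pow, Real.norm_eq_abs, sq_abs,
        Real.sq_sqrt (by norm_num : (0 : ℝ) ≤ 2 / 3)]
    simp_rw [h]
    rw [integral_const_mul, integral_norm_sq_gpForce]
    norm_num
  set Φ : ForcingShape (Fin 3) := ⟨Real.sqrt (2 / 3) • (fun x : UnitAddTorus (Fin 3) =>
      (Torus.stokesMode (Pi.single (2 : Fin 3) (1 : ℤ)) (EuclideanSpace.single (0 : Fin 3) (1 : ℝ)) false x +
        Torus.stokesMode (Pi.single (0 : Fin 3) (1 : ℤ)) (EuclideanSpace.single (1 : Fin 3) (1 : ℝ)) false x +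
        Torus.stokesMode (Pi.single (1 : Fin 3) (1 : ℤ)) (EuclideanSpace.single (2 : Fin 3) (1 : ℝ)) false x :
        EuclideanSpace ℝ (Fin 3))), hsm.smul _,
    Torus.isDivFree_const_smul (hsm.isContDiff (by simp)) hdf _, Torus.hasZeroMean_const_smul hzm _, hnorm⟩
    with hΦ
  set F : ℝ := Real.sqrt (3 / 2) with hF
  -- `f_GP = F Φ_GP` at scale `ℓ = 1`
  have hforce : Φ.force 1 F = (fun x : UnitAddTorus (Fin 3) =>
      (Torus.stokesMode (Pi.single (2 : Fin 3) (1 : ℤ)) (EuclideanSpace.single (0 : Fin 3) (1 : ℝ)) false x +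
        Torus.stokesMode (Pi.single (0 : Fin 3) (1 : ℤ)) (EuclideanSpace.single (1 : Fin 3) (1 : ℝ)) false x +
        Torus.stokesMode (Pi.single (1 : Fin 3) (1 : ℤ)) (EuclideanSpace.single (2 : Fin 3) (1 : ℝ)) false x :
        EuclideanSpace ℝ (Fin 3))) := by
    funext x
    simp only [ForcingShape.force, hΦ, one_nsmul, Pi.smul_apply, smul_smul]
    rw [← Real.sqrt_mul (by norm_num : (0 : ℝ) ≤ 3 / 2), show (3 / 2 : ℝ) * (2 / 3) = 1 by norm_num,
      Real.sqrt_one, one_smul]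
  obtain ⟨M, hM0, hM⟩ := exists_norm_laplacian_force_le Φ
  obtain ⟨D, hD0, hD⟩ := exists_sum_norm_partialDeriv_comp_nsmul_le Φ
  have hFpos : 0 < F := Real.sqrt_pos.mpr (by norm_num)
  have hS : 0 < D + M + 1 := by linarith
  set U₀ : ℝ := min 1 (F / (D + M + 1)) with hU₀
  have hU₀pos : 0 < U₀ := lt_min one_pos (div_pos hFpos hS)
  refine ⟨U₀ ^ 2, pow_pos hU₀pos 2, fun ν u₀ u hν hν1 hu => ?_⟩
  -- the Leray–Hopf solution is driven by `F Φ_GP`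
  have hu' : Torus.IsGlobalLerayHopf ν (fun _ => Φ.force 1 F) u₀ u := by rwa [hforce]
  have hCΨ : ∀ x, ∑ i, ‖Torus.partialDeriv i (Φ.force 1 1) x‖ ≤ D := fun x => by
    rw [force_one_eq]; simpa using hD 1 x
  have hL : ∀ x, ‖Torus.laplacian (Φ.force 1 1) x‖ ≤ M := fun x => by simpa using hM 1 1 x
  have key := DoeringFoias.abs_amplitude_le_of_isGlobalLerayHopf hν one_pos hu' hD0 hM0 hCΨ hL
  set U := rmsVelocity longTimeAvgSup u with hU
  have hUdef : U = Real.sqrt (meanEnergy u) := rfl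
  have hU0 : 0 ≤ U := Real.sqrt_nonneg _
  have hE0 : 0 ≤ meanEnergy u := meanEnergy_nonneg u
  rw [abs_of_pos hFpos] at key
  -- if `meanEnergy u < U₀²` then `U < U₀ ≤ 1` and the amplitude bound fails
  by_contra hcon
  have hlt : meanEnergy u < U₀ ^ 2 := lt_of_not_ge hcon
  have hUlt : U < U₀ := by
    rw [hUdef]
    calc Real.sqrt (meanEnergy u) < Real.sqrt (U₀ ^ 2) := Real.sqrt_lt_sqrt hE0 hlt
      _ = U₀ := Real.sqrt_sq hU₀pos.le
  have hU1 : U ≤ 1 := (hUlt.le.trans (min_le_left _ _))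
  have hUF : U < F / (D + M + 1) := hUlt.trans_le (min_le_right _ _)
  have h1 : D * U ^ 2 ≤ D * U := by
    have : U ^ 2 ≤ U := by nlinarith
    exact mul_le_mul_of_nonneg_left this hD0
  have h2 : ν * M * U ≤ M * U := by
    have : ν * M ≤ M := by nlinarith
    exact mul_le_mul_of_nonneg_right this hU0
  have h3 : (D + M + 1) * U < F := by
    have := (lt_div_iff₀ hS).mp hUF
    linarith [this]
  nlinarith [key, h1, h2, h3, hU0]

/-- **Every witness of the crux sits above the floor**: if `(E, ν, u₀, u)` satisfies the viscosity,
Leray–Hopf and mean-energy clauses of `GPMeanBoundedFamily` (the lift clause is not even needed), then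
`e₀ ≤ E` for the constant of `exists_meanEnergy_floor`. [folklore] -/
theorem level_floor : ∃ e₀ : ℝ, 0 < e₀ ∧
    ∀ f : UnitAddTorus (Fin 3) → EuclideanSpace ℝ (Fin 3), f = (fun x : UnitAddTorus (Fin 3) =>
      (Torus.stokesMode (Pi.single (2 : Fin 3) (1 : ℤ)) (EuclideanSpace.single (0 : Fin 3) (1 : ℝ)) false x +
        Torus.stokesMode (Pi.single (0 : Fin 3) (1 : ℤ)) (EuclideanSpace.single (1 : Fin 3) (1 : ℝ)) false x +
        Torus.stokesMode (Pi.single (1 : Fin 3) (1 : ℤ)) (EuclideanSpace.single (2 : Fin 3) (1 : ℝ)) false x :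
        EuclideanSpace ℝ (Fin 3))) →
    ∀ (E : ℝ) (ν : ℕ → ℝ) (u₀ : ℕ → UnitAddTorus (Fin 3) → EuclideanSpace ℝ (Fin 3))
      (u : ℕ → ℝ → UnitAddTorus (Fin 3) → EuclideanSpace ℝ (Fin 3)),
      (∀ j, 0 < ν j ∧ ν j ≤ 1) →
      (∀ j, Torus.IsGlobalLerayHopf (ν j) (fun _ => f) (u₀ j) (u j)) →
      (∀ j, meanEnergy (u j) ≤ E) → e₀ ≤ E := by
  obtain ⟨e₀, he₀, hfloor⟩ := exists_meanEnergy_floor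
  refine ⟨e₀, he₀, fun f hf E ν u₀ u hν hLH hE => ?_⟩
  subst hf
  exact (hfloor (ν 0) (u₀ 0) (u 0) (hν 0).1 (hν 0).2 (hLH 0)).trans (hE 0)

/-- **The every-level strengthening is false.** NATURAL STRENGTHENING of the crux (stated inline, no new
fact): mean-bounded lifted Leray–Hopf families of NS_{ν_j}(f_GP), `ν_j → 0`, exist AT EVERY positive level `E`
(the body of `EnsembleRigidity.GPMeanBoundedFamily` with `∃ E` replaced by `∀ E > 0`). Refuted: below the
Doering–Foias floor `e₀` no Leray–Hopf solution of NS_ν(f_GP), `ν ≤ 1`, has its mean energy, so no family is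
mean-bounded by `E = e₀/2`. (Small-level kill; the crux itself only asks for SOME level and is untouched.)
[folklore] -/
theorem not_atEveryLevel : ¬ (∀ f : UnitAddTorus (Fin 3) → EuclideanSpace ℝ (Fin 3), f = (fun x : UnitAddTorus (Fin 3) =>
      (Torus.stokesMode (Pi.single (2 : Fin 3) (1 : ℤ)) (EuclideanSpace.single (0 : Fin 3) (1 : ℝ)) false x +
        Torus.stokesMode (Pi.single (0 : Fin 3) (1 : ℤ)) (EuclideanSpace.single (1 : Fin 3) (1 : ℝ)) false x +
        Torus.stokesMode (Pi.single (1 : Fin 3) (1 : ℤ)) (EuclideanSpace.single (2 : Fin 3) (1 : ℝ)) false x :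
        EuclideanSpace ℝ (Fin 3))) →
    ∀ E : ℝ, 0 < E →
    ∃ (ν : ℕ → ℝ) (u₀ : ℕ → UnitAddTorus (Fin 3) → EuclideanSpace ℝ (Fin 3))
      (u : ℕ → ℝ → UnitAddTorus (Fin 3) → EuclideanSpace ℝ (Fin 3))
      (U : ℕ → ℝ → Literature.Analysis.FunctionSpaces.Torus.energySpace (Fin 3)),
      (∀ j, 0 < ν j ∧ ν j ≤ 1) ∧ Filter.Tendsto ν Filter.atTop (nhds 0) ∧
      (∀ j, Torus.IsGlobalLerayHopf (ν j) (fun _ => f) (u₀ j) (u j)) ∧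
      (∀ j t, 0 ≤ t → ((U j t : MeasureTheory.Lp (EuclideanSpace ℝ (Fin 3)) 2
        (MeasureTheory.volume : MeasureTheory.Measure (UnitAddTorus (Fin 3)))) :
          UnitAddTorus (Fin 3) → EuclideanSpace ℝ (Fin 3)) =ᵐ[MeasureTheory.volume] u j t) ∧
      ∀ j, meanEnergy (u j) ≤ E) := by
  intro h
  obtain ⟨e₀, he₀, hfloor⟩ := level_floor
  obtain ⟨ν, u₀, u, U, hν, -, hLH, -, hE⟩ := h _ rfl (e₀ / 2) (half_pos he₀)
  have := hfloor _ rfl (e₀ / 2) ν u₀ u hν hLH hE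
  linarith

end Summit.AnomalousDissipation.AnomalousDissipation.Theorems.GPMeanBoundedFamily.Negative
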